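import Summits.AtomisticToContinuum.Crystallization.Theorems.FrustratedLawDichotomySignedLedgerHardCoreClass

/-!
# FrustratedLawDichotomy · crux `AperiodicFrustratedLawGap` (stmt-AtomisticToContinuum-27623) — COHERENT SETS, TYPED
# (decomp-a2c lens-5 g111; ORDER (d) of critic rows 1698 (C) / 1702 (B): «`C_coh` as a Lean `Set (Measure E3)` + `MeasurableSet`»)

The root-local coherence condition of the E′ doors (#55 `…SignedLedgerTwoRegimeDoor`, #56 `…SignedLedgerTextureDoor`, lens-5 g111
`…CoherentDriftDoor`) is here a literal set of rooted configurations.  For a finite TEMPLATE `a : Finset E3` (the host window: the points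
`L n`, `n ∈ B`, of a host `L` — Bravais, multilattice or any finite point set; the root's own site is `0 ∈ a` when wanted), a tolerance `τ`
and a window radius `R`:

  `coherentAt a τ R = {μ | every template ball `closedBall x τ`, `x ∈ a`, carries mass} ∩ {μ | no mass in `closedBall 0 R` outside them}`.

* `measurableSet_coherentAt` — it is measurable (evaluation `μ ↦ μ s` is measurable for measurable `s`), hence so is every countable union
  over a host net (`measurableSet_iUnion_coherentAt`): this IS the socket `hC : ∀ δ i, MeasurableSet (C δ i)` of the three doors, with
  `C δ i := coherentAt (tmpl i) (τ i) (R i)` for any countable net of templates (e.g. rational templates).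
* `count_restrict_mem_coherentAt_iff` — on configurations `count.restrict S` (the form every a.s.-rooted-hard-core `μ` has, #52
  `exists_eq_count_restrict_of_ballCondition`) membership reads: every template ball meets `S`, and `S ∩ closedBall 0 R` lies in the union of
  the template balls.  With `2τ < δ` (hard core) each ball then holds exactly one atom, i.e. the window is a `τ`-perturbation of the template —
  the «`(L, τ)`-coherent `R`-ball» of lens-5 g110/g111 and of critic row 1703 (B) «C OF RECORD».
* `coherentAt_mono` — monotone in the tolerance; `existsUnique_atom_of_mem_coherentAt` — with a hard core `δ > 2τ` every template ball holds
  exactly one atom (the window is a genuine `τ`-perturbation of the template).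

STRICTLY WEAKER THAN THE TARGET: definitions and measurability bookkeeping only; no energy, no probability.  [folklore] throughout.
No `sorry`, no new axioms, no instances, no notation.
-/

noncomputable section

namespace Summit.AtomisticToContinuum.Crystallization.Theorems.FrustratedLawDichotomyCoherentSets

open MeasureTheory Metric Set
open scoped ENNReal
open Summit.AtomisticToContinuum.Crystallization.Theorems.ChargedEnergyGapNegative (E3)

/-- **The coherent set of a template.**  `μ ∈ coherentAt a τ R` iff every ball `closedBall x τ` (`x ∈ a`) has positive `μ`-mass and
`closedBall 0 R` carries no `μ`-mass outside `⋃ x ∈ a, closedBall x τ`. -/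
def coherentAt (a : Finset E3) (τ R : ℝ) : Set (Measure E3) :=
  (⋂ x ∈ a, {μ : Measure E3 | μ (closedBall x τ) ≠ 0}) ∩
    {μ : Measure E3 | μ (closedBall (0 : E3) R \ ⋃ x ∈ a, closedBall x τ) = 0}

/-- Membership, unfolded. [folklore] -/
theorem mem_coherentAt_iff (a : Finset E3) (τ R : ℝ) (μ : Measure E3) :
    μ ∈ coherentAt a τ R ↔ (∀ x ∈ a, μ (closedBall x τ) ≠ 0) ∧ μ (closedBall (0 : E3) R \ ⋃ x ∈ a, closedBall x τ) = 0 := by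
  simp only [coherentAt, mem_inter_iff, mem_iInter, mem_setOf_eq]

/-- The window region outside the template balls is measurable. [folklore] -/
theorem measurableSet_window_diff (a : Finset E3) (τ R : ℝ) :
    MeasurableSet (closedBall (0 : E3) R \ ⋃ x ∈ a, closedBall x τ) :=
  measurableSet_closedBall.diff (Finset.measurableSet_biUnion a fun _ _ => measurableSet_closedBall)

/-- **`coherentAt a τ R` is a measurable set of configurations** — the `hC` socket of the E′ doors. [folklore] -/
theorem measurableSet_coherentAt (a : Finset E3) (τ R : ℝ) : MeasurableSet (coherentAt a τ R) := by
  refine (Finset.measurableSet_biInter a fun x _ => ?_).inter ?_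
  · exact (Measure.measurable_coe measurableSet_closedBall) (measurableSet_singleton 0).compl
  · exact (Measure.measurable_coe (measurableSet_window_diff a τ R)) (measurableSet_singleton 0)

/-- A countable net of templates gives a measurable coherence condition `⋃ i, coherentAt (tmpl i) (τ i) (R i)` (and each member is
measurable) — literally the hypotheses `hC` of `…TwoRegimeDoor` / `…TextureDoor` / `…CoherentDriftDoor`. [folklore] -/
theorem measurableSet_iUnion_coherentAt {ι : Type*} [Countable ι] (tmpl : ι → Finset E3) (τ R : ι → ℝ) :
    MeasurableSet (⋃ i, coherentAt (tmpl i) (τ i) (R i)) :=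
  MeasurableSet.iUnion fun i => measurableSet_coherentAt (tmpl i) (τ i) (R i)

/-- Monotone in the tolerance: a `τ`-coherent window is `τ'`-coherent for `τ ≤ τ'`. [folklore] -/
theorem coherentAt_mono (a : Finset E3) {τ τ' : ℝ} (h : τ ≤ τ') (R : ℝ) : coherentAt a τ R ⊆ coherentAt a τ' R := by
  intro μ hμ
  rw [mem_coherentAt_iff] at hμ ⊢
  refine ⟨fun x hx h0 => hμ.1 x hx (measure_mono_null (closedBall_subset_closedBall h) h0), ?_⟩
  refine measure_mono_null (sdiff_le_sdiff_left ?_) hμ.2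
  exact iUnion₂_mono fun x _ => closedBall_subset_closedBall h

/-- **Membership for configurations.**  For `μ = count.restrict S`: every template ball meets `S`, and the atoms of the window lie in
the template balls. [folklore] -/
theorem count_restrict_mem_coherentAt_iff (S : Set E3) (a : Finset E3) (τ R : ℝ) :
    (Measure.count.restrict S : Measure E3) ∈ coherentAt a τ R ↔
      (∀ x ∈ a, (closedBall x τ ∩ S).Nonempty) ∧ (closedBall (0 : E3) R \ ⋃ x ∈ a, closedBall x τ) ∩ S = ∅ := by
  rw [mem_coherentAt_iff]
  refine and_congr (forall₂_congr fun x _ => ?_) ?_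
  · rw [Measure.restrict_apply measurableSet_closedBall, Measure.count_ne_zero_iff]
  · rw [Measure.restrict_apply (measurableSet_window_diff a τ R), Measure.count_eq_zero_iff]

/-- The same, with the second clause as an inclusion: the window's atoms lie in the template balls. [folklore] -/
theorem count_restrict_mem_coherentAt_iff' (S : Set E3) (a : Finset E3) (τ R : ℝ) :
    (Measure.count.restrict S : Measure E3) ∈ coherentAt a τ R ↔
      (∀ x ∈ a, (closedBall x τ ∩ S).Nonempty) ∧ S ∩ closedBall (0 : E3) R ⊆ ⋃ x ∈ a, closedBall x τ := by
  rw [count_restrict_mem_coherentAt_iff]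
  refine and_congr Iff.rfl ⟨fun h p hp => ?_, fun h => ?_⟩
  · by_contra hne
    have : p ∈ (closedBall (0 : E3) R \ ⋃ x ∈ a, closedBall x τ) ∩ S := ⟨⟨hp.2, hne⟩, hp.1⟩
    rw [h] at this
    exact this
  · refine eq_empty_of_forall_notMem fun p hp => hp.1.2 (h ⟨hp.2, hp.1.1⟩)

/-- In a `δ`-separated set, a ball of radius `τ` with `2τ < δ` holds at most one point. [folklore] -/
theorem subsingleton_closedBall_inter_of_separated {S : Set E3} {δ τ : ℝ}
    (hS : ∀ x ∈ S, ∀ x' ∈ S, x ≠ x' → δ ≤ dist x x') (hτ : 2 * τ < δ) (c : E3) : (closedBall c τ ∩ S).Subsingleton := by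
  intro p hp q hq
  by_contra hne
  have h1 := hS p hp.2 q hq.2 hne
  have h2 : dist p q ≤ τ + τ := (dist_triangle p c q).trans (add_le_add (mem_closedBall.mp hp.1) (by
    rw [dist_comm]; exact mem_closedBall.mp hq.1))
  linarith

/-- **Coherent windows of hard-core configurations are perturbations of the template**: if `S` is `δ`-separated with `2τ < δ` and
`count.restrict S ∈ coherentAt a τ R`, then every template ball holds EXACTLY ONE atom (and, by `count_restrict_mem_coherentAt_iff'`, the
window's atoms all lie in template balls) — the «`(L, τ)`-coherent `R`-ball» as a bijection template ↔ window atoms. [folklore] -/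
theorem existsUnique_atom_of_mem_coherentAt {S : Set E3} {δ τ R : ℝ} {a : Finset E3}
    (hS : ∀ x ∈ S, ∀ x' ∈ S, x ≠ x' → δ ≤ dist x x') (hτ : 2 * τ < δ)
    (h : (Measure.count.restrict S : Measure E3) ∈ coherentAt a τ R) : ∀ x ∈ a, ∃! p : E3, p ∈ closedBall x τ ∩ S := by
  intro x hx
  obtain ⟨p, hp⟩ := ((count_restrict_mem_coherentAt_iff S a τ R).mp h).1 x hx
  exact ⟨p, hp, fun q hq => subsingleton_closedBall_inter_of_separated hS hτ x hq hp⟩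

end Summit.AtomisticToContinuum.Crystallization.Theorems.FrustratedLawDichotomyCoherentSets

end
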